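import Summits.BirchSwinnertonDyer.BirchSwinnertonDyer.Theorems.PrintCFramBottomClassIndexLawFiveLeHerbrandRationalFields

/-!
# Road C, stub D (Galois half), file 4: the dictionary data of LEAD g9's swap theorem — the quadratic character `ε`
# of `K''/ℚ` with values in `(ℤ/p)ˣ`, an element `c` with `ε c = -1`, `hN`, `N′ ≤ N`, `N^{p-1} ⊆ N′`, open kernel of `r = b ∘ χ_m`

Summit `BirchSwinnertonDyer`, crux `PrintCFram.BottomClassIndexLawFiveLe` (stmt-BirchSwinnertonDyer-20372), line
`eisenstein-resource-bdp-line`, Stub H′; width seat `bsd-line-cfram-p1-w4` g5, typing item «D-gal» of LEAD g9's ROAD C (sequel of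
`…HerbrandRationalFields.lean`).  HONEST FRAMING: bookkeeping for the hypotheses `hεK`, `hε`, `hc`, `hN`, `hN'N`, `hNN'` of LEAD g9's
`HerbrandSwap.forall_hom_character_primesAbove_of_oddVanish_of_evenVanish` (p655661); no summit statement is proved here, no stub is closed.

* §1 **`exists_quadraticCharacter`**: for `K/ℚ` Galois of degree `2` and `p ≠ 2` there is `ε : Γ_ℚ →* (ZMod p)ˣ` with
  `g ∈ range res_{ℚ,K} ↔ ε g = 1` (`hεK`), `ε g = 1 ∨ ε g = -1` (`hε`) and some `c` with `ε c = -1` (`hc`); helpers `neg_one_ne_one_units`,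
  `exists_gal_forall_eq_of_finrank_eq_two`, `exists_not_mem_range_absGaloisRestrict`.
* §2 `isOpen_ker_comp_modNCyclotomicCharacter` (`r = b ∘ χ_m` has open kernel), **`mem_ker_inf_range_iff_of_forall_eq`** (`hN` for
  `N = ker r ⊓ range res` and `θ` with `θ σ = r (res σ)`), **`exists_pow_mem_inf_ker`** (`hNN'` with `k = p - 1` for `N′ = N ⊓ ker χ̄_p`),
  `inf_ker_le` (`hN'N`).

References: J. Neukirch, *Algebraic Number Theory*, Ch. IV §1 [NeukirchANT1999]; LEAD g9's `…HerbrandConjugationSwapRational.lean` (p655661).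
-/

noncomputable section

-- summit-side namespace `Summit.BirchSwinnertonDyer.BirchSwinnertonDyer.…` (single-conjunct summit, D-0017 layout)
set_option linter.dupNamespace false
set_option autoImplicit false

open scoped Classical Pointwise
open NumberField IsDedekindDomain Field
open Literature.NumberTheory.GaloisRepresentations

namespace Summit.BirchSwinnertonDyer.BirchSwinnertonDyer.Theorems.PrintCFram.HerbrandSelmerToHom

/-! ### §1 The quadratic character of `K/ℚ` with values in `(ℤ/p)ˣ` -/

section Quadratic

variable {p : ℕ}

/-- `-1 ≠ 1` in `(ℤ/p)ˣ` for a prime `p ≠ 2`. [folklore] -/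
theorem neg_one_ne_one_units (hp : p.Prime) (hp2 : p ≠ 2) : (-1 : (ZMod p)ˣ) ≠ 1 := by
  intro h
  have h1 : ((-1 : (ZMod p)ˣ) : ZMod p) = ((1 : (ZMod p)ˣ) : ZMod p) := by rw [h]
  rw [Units.val_neg, Units.val_one] at h1
  have h2 : ((2 : ℕ) : ZMod p) = 0 := by
    have e : (-1 : ZMod p) + 1 = 0 := neg_add_cancel 1
    rw [h1] at e
    calc ((2 : ℕ) : ZMod p) = 1 + 1 := by norm_num
      _ = 0 := e
  rw [ZMod.natCast_eq_zero_iff] at h2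
  exact hp2 ((Nat.prime_dvd_prime_iff_eq hp Nat.prime_two).mp h2)

variable {K : Type} [Field K] [NumberField K] [IsGalois ℚ K]

/-- A Galois extension of degree `2` has Galois group `{1, σ₀}` with `σ₀ ≠ 1`, `σ₀² = 1`. [folklore] -/
theorem exists_gal_forall_eq_of_finrank_eq_two (hK : Module.finrank ℚ K = 2) :
    ∃ σ₀ : K ≃ₐ[ℚ] K, σ₀ ≠ 1 ∧ σ₀ * σ₀ = 1 ∧ ∀ σ : K ≃ₐ[ℚ] K, σ = 1 ∨ σ = σ₀ := by
  haveI : FiniteDimensional ℚ K := Module.Finite.of_restrictScalars_finite ℚ ℚ K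
  have hcard : Nat.card (K ≃ₐ[ℚ] K) = 2 := by rw [IsGalois.card_aut_eq_finrank, hK]
  obtain ⟨x, y, hxy, hxy'⟩ := Nat.card_eq_two_iff.mp hcard
  have hall : ∀ σ : K ≃ₐ[ℚ] K, σ = x ∨ σ = y := fun σ => by
    have h : σ ∈ ({x, y} : Set (K ≃ₐ[ℚ] K)) := by rw [hxy']; exact Set.mem_univ σ
    simpa using h
  -- the non-trivial element
  obtain ⟨σ₀, hσ₀, hσ₀'⟩ : ∃ σ₀ : K ≃ₐ[ℚ] K, σ₀ ≠ 1 ∧ ∀ σ : K ≃ₐ[ℚ] K, σ = 1 ∨ σ = σ₀ := by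
    rcases hall 1 with h1 | h1
    · exact ⟨y, fun h => hxy (h1.symm.trans h.symm), fun σ => by rcases hall σ with h | h <;> [exact Or.inl (h.trans h1.symm); exact Or.inr h]⟩
    · exact ⟨x, fun h => hxy (h.trans h1), fun σ => by rcases hall σ with h | h <;> [exact Or.inr h; exact Or.inl (h.trans h1.symm)]⟩
  refine ⟨σ₀, hσ₀, ?_, hσ₀'⟩
  rcases hσ₀' (σ₀ * σ₀) with h | h
  · exact h
  · exact absurd (mul_left_cancel (h.trans (mul_one σ₀).symm)) hσ₀

/-- For `[K:ℚ] = 2` some element of `Γ_ℚ` does not restrict into `Γ_K` (`[Γ_ℚ : res Γ_K] = 2`). [folklore] -/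
theorem exists_not_mem_range_absGaloisRestrict (hK : Module.finrank ℚ K = 2) :
    ∃ c : absoluteGaloisGroup ℚ, c ∉ (absGaloisRestrict ℚ K).range := by
  haveI : FiniteDimensional ℚ K := Module.Finite.of_restrictScalars_finite ℚ ℚ K
  by_contra h
  have h' : ∀ g : absoluteGaloisGroup ℚ, g ∈ (absGaloisRestrict ℚ K).range := fun g => by
    by_contra hg
    exact h ⟨g, hg⟩
  have htop : (absGaloisRestrict ℚ K).range = ⊤ := top_unique fun g _ => h' g
  have hidx := SorensenPatching.index_range_absGaloisRestrict ℚ K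
  rw [htop, Subgroup.index_top, hK] at hidx
  exact absurd hidx (by norm_num)

/-- **The quadratic character `ε : Γ_ℚ → {±1} ⊂ (ℤ/p)ˣ` of a quadratic `K/ℚ`** (`p ≠ 2`): kernel `res Γ_K` (LEAD g9's `hεK`), values `±1`
(`hε`), and an element `c` with `ε c = -1` (`hc`). [cite: NeukirchANT1999, Ch. IV §1] -/
theorem exists_quadraticCharacter [Fact p.Prime] (hp2 : p ≠ 2) (hK : Module.finrank ℚ K = 2) :
    ∃ ε : absoluteGaloisGroup ℚ →* (ZMod p)ˣ,
      (∀ g : absoluteGaloisGroup ℚ, g ∈ (absGaloisRestrict ℚ K).range ↔ ε g = 1) ∧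
      (∀ g : absoluteGaloisGroup ℚ, ε g = 1 ∨ ε g = -1) ∧
      ∃ c : absoluteGaloisGroup ℚ, ε c = -1 := by
  have hp : p.Prime := Fact.out
  obtain ⟨σ₀, hσ₀, hsq, hall⟩ := exists_gal_forall_eq_of_finrank_eq_two (K := K) hK
  have h10 : (1 : K ≃ₐ[ℚ] K) ≠ σ₀ := fun h => hσ₀ h.symm
  let ε₀ : (K ≃ₐ[ℚ] K) →* (ZMod p)ˣ := MonoidHom.mk' (fun σ => if σ = 1 then 1 else -1) (by
    intro a b
    rcases hall a with rfl | rfl <;> rcases hall b with rfl | rfl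
    · simp
    · simp [hσ₀]
    · simp [hσ₀]
    · simp [hsq, hσ₀])
  have hε₀ : ∀ σ, ε₀ σ = if σ = 1 then 1 else -1 := fun σ => rfl
  refine ⟨ε₀.comp (absGaloisQuot ℚ K), fun g => ?_, fun g => ?_, ?_⟩
  · rw [← absGaloisQuot_eq_one_iff, MonoidHom.comp_apply, hε₀]
    constructor
    · intro h; rw [if_pos h]
    · intro h
      by_contra hne
      rw [if_neg hne] at h
      exact neg_one_ne_one_units hp hp2 h
  · rw [MonoidHom.comp_apply, hε₀]
    split_ifs
    · exact Or.inl rfl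
    · exact Or.inr rfl
  · obtain ⟨c, hc⟩ := exists_not_mem_range_absGaloisRestrict (K := K) hK
    refine ⟨c, ?_⟩
    rw [← absGaloisQuot_eq_one_iff] at hc
    rw [MonoidHom.comp_apply, hε₀, if_neg hc]

end Quadratic

/-! ### §2 `hN`, `hN'N`, `hNN'`, and the open kernel of `r = b ∘ χ_m` -/

section Dictionary

variable {p : ℕ} {K : Type} [Field K] [NumberField K]

/-- `r = b ∘ χ_m` (`b : (ℤ/m)ˣ → A`) has open kernel: it contains the open subgroup `ker χ_m`. [folklore] -/
theorem isOpen_ker_comp_modNCyclotomicCharacter {A : Type*} [Group A] (m : ℕ) [NeZero m] (b : (ZMod m)ˣ →* A) :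
    IsOpen ((b.comp (modNCyclotomicCharacter ℚ m)).ker : Set (absoluteGaloisGroup ℚ)) := by
  refine Subgroup.isOpen_mono (H₁ := (modNCyclotomicCharacter ℚ m).ker) (fun g hg => ?_) (isOpen_ker_modNCyclotomicCharacter' ℚ m)
  rw [MonoidHom.mem_ker] at hg ⊢
  rw [MonoidHom.comp_apply, hg, map_one]

/-- A character equal to one with open kernel has open kernel (e.g. `r` with `∀ σ, r σ = b (χ_m σ)`). [folklore] -/
theorem isOpen_ker_of_forall_eq {A : Type*} [Group A] (r r' : absoluteGaloisGroup ℚ →* A) (h : ∀ g, r g = r' g)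
    (hr' : IsOpen (r'.ker : Set (absoluteGaloisGroup ℚ))) : IsOpen (r.ker : Set (absoluteGaloisGroup ℚ)) := by
  have e : r = r' := MonoidHom.ext h
  rw [e]
  exact hr'

/-- **LEAD g9's `hN`** for `N = ker r ⊓ range res_{ℚ,K}` and any `θ` with `θ σ = r (res σ)`. [folklore] -/
theorem mem_ker_inf_range_iff_of_forall_eq {A : Type*} [CommGroup A] (r : absoluteGaloisGroup ℚ →* A)
    (θ : absoluteGaloisGroup K →* A) (hθr : ∀ σ, θ σ = r (absGaloisRestrict ℚ K σ)) (g : absoluteGaloisGroup ℚ) :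
    g ∈ r.ker ⊓ (absGaloisRestrict ℚ K).range ↔ ∃ σ : absoluteGaloisGroup K, θ σ = 1 ∧ absGaloisRestrict ℚ K σ = g := by
  rw [mem_ker_inf_range_iff]
  simp only [hθr]

/-- **LEAD g9's `hNN'`** for `N′ = N ⊓ ker χ̄_p`: `∃ k, p ∤ k ∧ ∀ n ∈ N, n^k ∈ N′` (`k = p - 1`). [folklore] -/
theorem exists_pow_mem_inf_ker [Fact p.Prime] (N : Subgroup (absoluteGaloisGroup ℚ)) (χ : absoluteGaloisGroup ℚ →* (ZMod p)ˣ) :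
    ∃ k : ℕ, ¬ p ∣ k ∧ ∀ n ∈ N, n ^ k ∈ N ⊓ χ.ker :=
  ⟨p - 1, not_dvd_sub_one Fact.out, fun _ hn => pow_sub_one_mem_inf_ker N χ hn⟩

/-- **LEAD g9's `hN'N`**: `N ⊓ ker χ ≤ N`. [folklore] -/
theorem inf_ker_le (N : Subgroup (absoluteGaloisGroup ℚ)) {A : Type*} [Group A] (χ : absoluteGaloisGroup ℚ →* A) :
    N ⊓ χ.ker ≤ N :=
  inf_le_left

end Dictionary

end Summit.BirchSwinnertonDyer.BirchSwinnertonDyer.Theorems.PrintCFram.HerbrandSelmerToHom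

end
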